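import Literature.Probability.Percolation.SlabMSFLanding
import HarnessLib

/-!
# Newman–Tassion–Wu 2017, §4 (proof of Theorem 2.4) — the events `C`, `D′`, `𝓑_x^{m}` and the
# piece data of the gluing lemma for invasion, on the label space

Topic: `Literature/Probability/Percolation`.  Fifth file of the port of NTW's Lemma 4.1 (*Critical
percolation and the minimal spanning tree in slabs*, CPAM 70 (2017) = arXiv:1512.09107, §4, pp. 19–21).
NTW work on `Ω = [0,1]^E` with the product of uniforms (§2.3); the tree's label space is
`(Sym2 (slab 3 k) → ℝ, labelMeasure)` with the level-`p` configuration `η_p(U) = configOfLabels p U`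
(`Percolation.lean`), and the invasion is driven by `U` itself (`InvasionPercolation.lean`).  This
file NAMES, as sets of label fields / functions of the label field, the objects of §4 at one scale
`(n, N, M)` (NTW: `n = n_i`, `N = 2n_i`, `M = m_i - 1`) and root(s) `a`, `x`:

* `NTW17.goodLabels k` — `[0,1]^E` (an almost sure set: `ae_mem_goodLabels`);
* `NTW17.evCircuit k p n N` — **`C_{n,2n}`** pulled back: `η_p(U)` has an open circuit in `Ā_{n,N}`
  around the origin; `NTW17.circuitOf k p n N U` — **`Γ_min^{(i)}(ω)`**, the minimal such circuit;
* `NTW17.evBlocked k p N M` — **`D′ = D_{N+1,M+1}`** in the lane's repaired form (R1): no `p`-open path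
  inside `B̄_{M+1}` from `B̄_{N+1}` to `∂B̄_{M+1}` (a closed dual surface in `B̄_{M+1} ∖ B̄_{N+1}`);
* `NTW17.stoppedInv k M U a` — **`𝓘_a^{m}`**, the invasion of `a` "stopped when it first reaches any
  vertex in `∂B̄_m`" (the tree's invasion at its break-out time of the column ball `Λ_M`, `M = m-1`);
* `NTW17.evGlued k p n N M a` — **`𝓑_a^{m} = {Γ_min ⊆ 𝓘_a^{m}}`**;
* `NTW17.landZ`, `NTW17.landW` — `z(ω)`, `w(ω)` as functions of `U` alone (`zHat`, `wHat` of
  `SlabMSFLanding.lean` evaluated at `Γ = Γ_min(η_p(U))`);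
* `NTW17.evStepTwo k p n N M a x` — the event that the Step-2 test, in the reading (R2′), says "`Γ_w`
  is added": no vertex of `Γ_min` is joined to `w` in `cfgZ`;
* `NTW17.pieceS`, `NTW17.pieceLZ`, `NTW17.pieceLZW` — the data `Ŝ(U) = S`, `L̂(U) = E(Γ_z)` resp.
  `E(Γ_z) ∪ E(Γ_w)` of the tree's Lemma 4.2 (`labelMeasure_real_le_of_affineRelabel_self`).

PROVED here (label-space bookkeeping only): unfolding lemmas; `goodLabels` is almost sure;
`evCircuit`, `evBlocked` and the fibres `{circuitOf = Γ₀}` are measurable (pull-backs of local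
configuration events: `measurableSet_circuitAround`, `measurableSet_slabConn`, `minCircuit_local`);
`evCircuit`/`evBlocked`/`circuitOf` depend only on the labels of the pairs over `B_N`, resp. `B_{M+1}`
(`circuitOf_congr`, …).  Measurability of `evGlued`, `landZ`, `landW`, `evStepTwo` (which read the
invasion) and Lemma 4.1 itself are Summits-side (they import the lane's invasion theory).

## Sources

* C. M. Newman, V. Tassion, W. Wu, *Critical percolation and the minimal spanning tree in slabs*,
  Comm. Pure Appl. Math. 70 (2017) 2084–2120 = arXiv:1512.09107: §2.3 (`Ω = [0,1]^E`), §4 (the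
  events `C_{a,b}`, `D_{a,b}`, `𝓘_x^n`, `𝓑_x^{m_i}`, `𝒴_A^i`, `𝓩^i`, p. 19) and §4.1 (proof of
  Lemma 4.1: `z(ω)`, `w`, Steps 1–3, `S(ω′)`), pp. 20–21 [NewmanTassionWu2017].
-/

noncomputable section

namespace Literature.Probability.Percolation

open MeasureTheory LatticeModels SimpleGraph

namespace NTW17

variable (k : ℕ)

/-! ## The events and the data -/

/-- **`[0,1]^E`**: label fields with all labels in `[0,1]` (NTW's `Ω`; almost sure for `labelMeasure`).
[cite: NewmanTassionWu2017, §2.3 ("Ω = [0,1]^E … the underlying (product of uniforms) probability measure")] -/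
def goodLabels : Set (Sym2 (slab 3 k) → ℝ) := {U | ∀ e, U e ∈ Set.Icc (0 : ℝ) 1}

/-- **`C_{n,N}`** on the label space: `η_p(U)` has a `p`-open circuit in `Ā_{n,N}` surrounding the origin.
[cite: NewmanTassionWu2017, §4 ("C_{a,b} … there exists a p_c-open circuit in B̄_b ∖ B̄_a that surrounds the origin")] -/
def evCircuit (p : ℝ) (n N : ℕ) : Set (Sym2 (slab 3 k) → ℝ) :=
  {U | configOfLabels p U (slabGraph 3 k) ∈ circuitAround k ((0 : ℤ), (0 : ℤ)) n N}

/-- **`Γ_min^{(i)}(ω)`**: the minimal `p`-open circuit of `Ā_{n,N}` surrounding the origin, read in `η_p(U)`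
(the empty list off `C_{n,N}`). [cite: NewmanTassionWu2017, §4 ("Γ_min^{(i)}(ω) … the minimal p_c-open circuit in B̄_{2n_i} ∖ B̄_{n_i} that surrounds the origin")] -/
def circuitOf (p : ℝ) (n N : ℕ) (U : Sym2 (slab 3 k) → ℝ) : List (slab 3 k) :=
  minCircuit k (configOfLabels p U (slabGraph 3 k)) ((0 : ℤ), (0 : ℤ)) n N

/-- **`D′ = D_{N+1,M+1}`** (repair (R1): the closed dual surface is taken in `B̄_{M+1} ∖ B̄_{N+1}`):
no `p`-open path inside `B̄_{M+1}` from `B̄_{N+1}` to `∂B̄_{M+1}`.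
[cite: NewmanTassionWu2017, §4 ("D_{a,b} … there exists a p_c-closed dual surface in B̄_b ∖ B̄_a that surrounds the origin")] -/
def evBlocked (p : ℝ) (N M : ℕ) : Set (Sym2 (slab 3 k) → ℝ) :=
  {U | configOfLabels p U (slabGraph 3 k) ∉
    slabConn k (sqBox ((0 : ℤ), (0 : ℤ)) (M + 1)) (sqBox ((0 : ℤ), (0 : ℤ)) (N + 1)) (sqSphere ((0 : ℤ), (0 : ℤ)) (M + 1))}

/-- **`𝓘_a^{m}`, the stopped invasion**: the invaded region of `a` at its break-out time of the column
ball `Λ_M = B̄_M` (`M = m - 1`: "stopped when it first reaches any vertex in `∂B̄_m`"; the break-out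
vertex, on `∂B̄_m`, is included). [cite: NewmanTassionWu2017, §4 ("𝓘_x^n the invasion cluster starting at x, and stopped when it first reaches any vertex in ∂B̄_n")] -/
def stoppedInv (M : ℕ) (U : Sym2 (slab 3 k) → ℝ) (a : slab 3 k) : Finset (slab 3 k) :=
  Invasion.invasion (slabGraph 3 k) U a
    (Invasion.exitIndex (slabGraph 3 k) U a (ballFinset k ((0 : ℤ), (0 : ℤ)) M))

/-- **`𝓑_a^{m} = {Γ_min ⊆ 𝓘_a^{m}}`**. [cite: NewmanTassionWu2017, §4 ("𝓑_x^{m_i} = {ω : Γ_min^{(i)}(ω) ⊂ 𝓘_x^{m_i}(ω)}")] -/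
def evGlued (p : ℝ) (n N M : ℕ) (a : slab 3 k) : Set (Sym2 (slab 3 k) → ℝ) :=
  {U | ∀ g ∈ circuitOf k p n N U, g ∈ stoppedInv k M U a}

/-- **`z(ω)`** as a function of the label field: the landing vertex of the invasion of `a` on `∂R`,
`R` the inside of `Γ_min(η_p(U))`. [cite: NewmanTassionWu2017, §4.1 (proof of Lemma 4.1, z(ω) = 𝓘_0[τ_i])] -/
def landZ (p : ℝ) (n N : ℕ) (U : Sym2 (slab 3 k) → ℝ) (a : slab 3 k) : slab 3 k :=
  zHat k (circuitOf k p n N U) N U a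

/-- **`w`** as a function of the label field: the first vertex of `B̄₁^#(z′)` reached by the invasion of
`x` (before it leaves `Λ_M`). [cite: NewmanTassionWu2017, §4.1 (proof of Lemma 4.1, Step 2, w = 𝓘_x[τ_i^x])] -/
def landW (p : ℝ) (n N M : ℕ) (U : Sym2 (slab 3 k) → ℝ) (a x : slab 3 k) : slab 3 k :=
  wHat k (circuitOf k p n N U) (landZ k p n N U a) M U x

/-- **The Step-2 test** (reading (R2′): read after Steps 1 and 3): `Γ_w` IS added, i.e. no vertex of
`Γ_min` is joined to `w` by a `cfgZ`-open path. [cite: NewmanTassionWu2017, §4.1 (proof of Lemma 4.1, Step 2: "If w ∈ C_{p_c}(z), go to Step 3. If w ∉ C_{p_c}(z), … Open all the edges in Γ_w")] -/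
def evStepTwo (p : ℝ) (n N M : ℕ) (a x : slab 3 k) : Set (Sym2 (slab 3 k) → ℝ) :=
  {U | ∀ g ∈ circuitOf k p n N U,
    ¬ (openGraph (cfgZ k (configOfLabels p U (slabGraph 3 k)) (circuitOf k p n N U) (landZ k p n N U a))).Reachable
      (landW k p n N M U a x) g}

/-- **`Ŝ(U) = S(ω′)`**, the modified pairs of the surgery at the landing of `a`: the pairs inside
`B̄₁^#(z′)` with an endpoint off `Γ_min`. [cite: NewmanTassionWu2017, §4.1 ("Taking S(ω′) = B̄₁^#(z′) ∖ Γ_min(ω′)")] -/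
def pieceS (p : ℝ) (n N : ℕ) (a : slab 3 k) (U : Sym2 (slab 3 k) → ℝ) : Finset (Sym2 (slab 3 k)) :=
  surgFin k (circuitOf k p n N U) (landCol k (circuitOf k p n N U) (landZ k p n N U a))

/-- **`L̂(U) = E(Γ_z)`**, the lowered pairs of Steps 1 and 3. [cite: NewmanTassionWu2017, §4.1 (Step 1: "Open all the edges in Γ_z")] -/
def pieceLZ (p : ℝ) (n N : ℕ) (a : slab 3 k) (U : Sym2 (slab 3 k) → ℝ) : Finset (Sym2 (slab 3 k)) :=
  edgesFin k (gammaZ k (circuitOf k p n N U) (landZ k p n N U a))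

/-- **`L̂(U) = E(Γ_z) ∪ E(Γ_w)`**, the lowered pairs of Steps 1, 2 and 3. [cite: NewmanTassionWu2017, §4.1 (Steps 1–2: "Open all the edges in Γ_z", "Open all the edges in Γ_w")] -/
def pieceLZW (p : ℝ) (n N M : ℕ) (a x : slab 3 k) (U : Sym2 (slab 3 k) → ℝ) : Finset (Sym2 (slab 3 k)) :=
  pieceLZ k p n N a U ∪ edgesFin k (gammaW k (circuitOf k p n N U) (landZ k p n N U a) (landW k p n N M U a x))

variable {k}

/-! ## Unfolding -/

section Unfold

variable {p : ℝ} {n N M : ℕ} {U : Sym2 (slab 3 k) → ℝ} {a x : slab 3 k}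

/-- Membership in `goodLabels`. [cite: NewmanTassionWu2017, §2.3 (Ω = [0,1]^E)] -/
theorem mem_goodLabels_iff : U ∈ goodLabels k ↔ ∀ e, U e ∈ Set.Icc (0 : ℝ) 1 := Iff.rfl

/-- Membership in `evCircuit`. [cite: NewmanTassionWu2017, §4 (C_{a,b})] -/
theorem mem_evCircuit_iff :
    U ∈ evCircuit k p n N ↔ configOfLabels p U (slabGraph 3 k) ∈ circuitAround k ((0 : ℤ), (0 : ℤ)) n N :=
  Iff.rfl

/-- Membership in `evBlocked`. [cite: NewmanTassionWu2017, §4 (D_{a,b})] -/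
theorem mem_evBlocked_iff :
    U ∈ evBlocked k p N M ↔ configOfLabels p U (slabGraph 3 k) ∉
      slabConn k (sqBox ((0 : ℤ), (0 : ℤ)) (M + 1)) (sqBox ((0 : ℤ), (0 : ℤ)) (N + 1)) (sqSphere ((0 : ℤ), (0 : ℤ)) (M + 1)) :=
  Iff.rfl

/-- Membership in `evGlued`. [cite: NewmanTassionWu2017, §4 (𝓑_x^{m_i})] -/
theorem mem_evGlued_iff : U ∈ evGlued k p n N M a ↔ ∀ g ∈ circuitOf k p n N U, g ∈ stoppedInv k M U a := Iff.rfl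

/-- `circuitOf` unfolded. [cite: NewmanTassionWu2017, §4 (Γ_min^{(i)})] -/
theorem circuitOf_eq : circuitOf k p n N U = minCircuit k (configOfLabels p U (slabGraph 3 k)) ((0 : ℤ), (0 : ℤ)) n N :=
  rfl

/-- `stoppedInv` unfolded. [cite: NewmanTassionWu2017, §4 (𝓘_x^n)] -/
theorem stoppedInv_eq : stoppedInv k M U a = Invasion.invasion (slabGraph 3 k) U a
    (Invasion.exitIndex (slabGraph 3 k) U a (ballFinset k ((0 : ℤ), (0 : ℤ)) M)) := rfl

/-- `landZ` unfolded. [cite: NewmanTassionWu2017, §4.1 (z(ω))] -/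
theorem landZ_eq : landZ k p n N U a = zHat k (circuitOf k p n N U) N U a := rfl

/-- `landW` unfolded. [cite: NewmanTassionWu2017, §4.1 (w)] -/
theorem landW_eq : landW k p n N M U a x = wHat k (circuitOf k p n N U) (landZ k p n N U a) M U x := rfl

/-- Membership in `evStepTwo`. [cite: NewmanTassionWu2017, §4.1 (Step 2)] -/
theorem mem_evStepTwo_iff : U ∈ evStepTwo k p n N M a x ↔ ∀ g ∈ circuitOf k p n N U,
    ¬ (openGraph (cfgZ k (configOfLabels p U (slabGraph 3 k)) (circuitOf k p n N U) (landZ k p n N U a))).Reachable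
      (landW k p n N M U a x) g := Iff.rfl

/-- `pieceS` unfolded. [cite: NewmanTassionWu2017, §4.1 (S(ω′))] -/
theorem pieceS_eq : pieceS k p n N a U =
    surgFin k (circuitOf k p n N U) (landCol k (circuitOf k p n N U) (landZ k p n N U a)) := rfl

/-- `pieceLZ` unfolded. [cite: NewmanTassionWu2017, §4.1 (Step 1)] -/
theorem pieceLZ_eq : pieceLZ k p n N a U = edgesFin k (gammaZ k (circuitOf k p n N U) (landZ k p n N U a)) := rfl

/-- `pieceLZW` unfolded. [cite: NewmanTassionWu2017, §4.1 (Steps 1–2)] -/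
theorem pieceLZW_eq : pieceLZW k p n N M a x U = edgesFin k (gammaZ k (circuitOf k p n N U) (landZ k p n N U a)) ∪
    edgesFin k (gammaW k (circuitOf k p n N U) (landZ k p n N U a) (landW k p n N M U a x)) := rfl

/-- On `C_{n,N}` the minimal circuit is a surrounding open circuit of `Ā_{n,N}` in `η_p(U)`.
[cite: NewmanTassionWu2017, §4 (Γ_min^{(i)} on C_{n_i,2n_i})] -/
theorem isOpenCircuit_circuitOf (hC : U ∈ evCircuit k p n N) :
    IsOpenCircuit k (configOfLabels p U (slabGraph 3 k)) (slabLift k (annulus ((0 : ℤ), (0 : ℤ)) n N)) (circuitOf k p n N U) ∧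
      Surrounds k ((0 : ℤ), (0 : ℤ)) (circuitOf k p n N U) :=
  (minCircuit_spec hC).1

/-- The level-`p` configuration of a label field is a lattice configuration. [cite: NewmanTassionWu2017, §2.3 (ω_p ∈ {0,1}^E)] -/
theorem configOfLabels_subset_edgeSet (p : ℝ) (U : Sym2 (slab 3 k) → ℝ) :
    configOfLabels p U (slabGraph 3 k) ⊆ (slabGraph 3 k).edgeSet := fun _ h => h.1

end Unfold

/-! ## Locality in the labels -/

section Congr

variable {p : ℝ} {n N M : ℕ} {U U' : Sym2 (slab 3 k) → ℝ}

/-- Label fields agreeing on the graph pairs over `B` induce configurations agreeing on the pairs over `B`.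
[cite: NewmanTassionWu2017, §4 ("𝓩^{i-1} is measurable with respect to the state of edges in B̄_{m_{i-1}}")] -/
theorem configOfLabels_inter_sym2_eq {B : Set (ℤ × ℤ)}
    (h : ∀ e ∈ (slabGraph 3 k).edgeSet, (∀ v ∈ e, planar k v ∈ B) → U e = U' e) :
    configOfLabels p U (slabGraph 3 k) ∩ Set.sym2 (slabLift k B) =
      configOfLabels p U' (slabGraph 3 k) ∩ Set.sym2 (slabLift k B) := by
  ext e
  induction e using Sym2.ind with
  | h a b =>
    simp only [Set.mem_inter_iff, configOfLabels, Set.mem_setOf_eq, Set.mk_mem_sym2_iff, mem_slabLift_iff]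
    constructor
    · rintro ⟨⟨he, hU⟩, hB⟩
      refine ⟨⟨he, ?_⟩, hB⟩
      rwa [← h _ he fun v hv => by rcases Sym2.mem_iff.1 hv with rfl | rfl <;> [exact hB.1; exact hB.2]]
    · rintro ⟨⟨he, hU⟩, hB⟩
      refine ⟨⟨he, ?_⟩, hB⟩
      rwa [h _ he fun v hv => by rcases Sym2.mem_iff.1 hv with rfl | rfl <;> [exact hB.1; exact hB.2]]

/-- **`Γ_min` depends only on the labels of the graph pairs over `B_N`.**
[cite: NewmanTassionWu2017, Theorem 3.8 (Γ_min is measurable w.r.t. the edge variables of the annulus)] -/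
theorem circuitOf_congr (h : ∀ e ∈ (slabGraph 3 k).edgeSet, (∀ v ∈ e, planar k v ∈ sqBox ((0 : ℤ), (0 : ℤ)) N) → U e = U' e) :
    circuitOf k p n N U = circuitOf k p n N U' :=
  minCircuit_local (configOfLabels_inter_sym2_eq h)

/-- `C_{n,N}` depends only on the labels of the graph pairs over `B_N`. [cite: NewmanTassionWu2017, §4 (C_{n_i,2n_i} is a local event)] -/
theorem mem_evCircuit_congr (h : ∀ e ∈ (slabGraph 3 k).edgeSet, (∀ v ∈ e, planar k v ∈ sqBox ((0 : ℤ), (0 : ℤ)) N) → U e = U' e) :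
    U ∈ evCircuit k p n N ↔ U' ∈ evCircuit k p n N :=
  (determinedBy_iff _ _).1 (determinedBy_circuitAround ((0 : ℤ), (0 : ℤ)) n N) _ _ (configOfLabels_inter_sym2_eq h)

/-- `D′` depends only on the labels of the graph pairs over `B_{M+1}`. [cite: NewmanTassionWu2017, §4 (D_{2n_i,m_i} is a local event)] -/
theorem mem_evBlocked_congr
    (h : ∀ e ∈ (slabGraph 3 k).edgeSet, (∀ v ∈ e, planar k v ∈ sqBox ((0 : ℤ), (0 : ℤ)) (M + 1)) → U e = U' e) :
    U ∈ evBlocked k p N M ↔ U' ∈ evBlocked k p N M := by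
  rw [mem_evBlocked_iff, mem_evBlocked_iff, not_iff_not]
  exact (determinedBy_iff _ _).1 (determinedBy_slabConn k _ _ subset_rfl) _ _ (configOfLabels_inter_sym2_eq h)

end Congr

/-! ## Measurability and the almost sure set -/

section Measurable

variable {p : ℝ} {n N M : ℕ}

/-- `[0,1]^E` is measurable. [cite: NewmanTassionWu2017, §2.3 (Ω = [0,1]^E)] -/
theorem measurableSet_goodLabels : MeasurableSet (goodLabels k) := by
  have : goodLabels k = ⋂ e : Sym2 (slab 3 k), (fun U : Sym2 (slab 3 k) → ℝ => U e) ⁻¹' Set.Icc (0 : ℝ) 1 := by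
    ext U; simp [goodLabels]
  rw [this]
  exact MeasurableSet.iInter fun e => measurableSet_Icc.preimage (measurable_pi_apply e)

/-- A single label lies outside `[0,1]` with probability `0`. [cite: NewmanTassionWu2017, §2.3 (product of uniforms on [0,1])] -/
theorem labelMeasure_setOf_not_mem_Icc (e : Sym2 (slab 3 k)) :
    labelMeasure (slab 3 k) {U | U e ∉ Set.Icc (0 : ℝ) 1} = 0 := by
  haveI := isProbabilityMeasure_volume_restrict_unitInterval
  have hset : {U : Sym2 (slab 3 k) → ℝ | U e ∉ Set.Icc (0 : ℝ) 1} =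
      (fun U : Sym2 (slab 3 k) → ℝ => U e) ⁻¹' (Set.Icc (0 : ℝ) 1)ᶜ := rfl
  rw [hset, ← Measure.map_apply (measurable_pi_apply e) measurableSet_Icc.compl, labelMeasure,
    Measure.infinitePi_map_eval, Measure.restrict_apply measurableSet_Icc.compl, Set.compl_inter_self, measure_empty]

/-- **Almost every label field lies in `[0,1]^E`.** [cite: NewmanTassionWu2017, §2.3 (Ω = [0,1]^E with the product of uniforms)] -/
theorem ae_mem_goodLabels : ∀ᵐ U ∂(labelMeasure (slab 3 k)), U ∈ goodLabels k := by
  have : ∀ᵐ U ∂(labelMeasure (slab 3 k)), ∀ e : Sym2 (slab 3 k), U e ∈ Set.Icc (0 : ℝ) 1 := by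
    refine ae_all_iff.2 fun e => ?_
    have h0 := labelMeasure_setOf_not_mem_Icc (k := k) e
    rw [← compl_mem_ae_iff] at h0
    filter_upwards [h0] with U hU
    simpa using hU
  exact this

/-- `C_{n,N}` is measurable on the label space. [cite: NewmanTassionWu2017, §4 (C_{a,b})] -/
theorem measurableSet_evCircuit : MeasurableSet (evCircuit k p n N) :=
  (measurableSet_circuitAround ((0 : ℤ), (0 : ℤ)) n N).preimage (measurable_configOfLabels p (slabGraph 3 k))

/-- `D′` is measurable on the label space. [cite: NewmanTassionWu2017, §4 (D_{a,b})] -/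
theorem measurableSet_evBlocked : MeasurableSet (evBlocked k p N M) :=
  ((measurableSet_slabConn k ((0 : ℤ), (0 : ℤ)) (M + 1) _ _).preimage (measurable_configOfLabels p (slabGraph 3 k))).compl

/-- The event "the minimal circuit is `Γ₀`" is a local configuration event, hence measurable.
[cite: NewmanTassionWu2017, Theorem 3.8 (Γ_min measurable w.r.t. the edge variables of the annulus)] -/
theorem measurableSet_minCircuit_eq (Γ₀ : List (slab 3 k)) :
    MeasurableSet {ω : BondConfig (slab 3 k) | minCircuit k ω ((0 : ℤ), (0 : ℤ)) n N = Γ₀} := by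
  refine measurableSet_of_isLocalEvent_holds ⟨(finite_sym2 (slabLift_finite k (sqBox_finite ((0 : ℤ), (0 : ℤ)) N))).toFinset, ?_⟩
  rw [Set.Finite.coe_toFinset, determinedBy_iff]
  intro ω ω' h
  simp only [Set.mem_setOf_eq]
  rw [minCircuit_local h]

/-- **The fibres `{Γ_min(η_p(U)) = Γ₀}` are measurable** on the label space. [cite: NewmanTassionWu2017, Theorem 3.8 (Γ_min measurable)] -/
theorem measurableSet_circuitOf_eq (Γ₀ : List (slab 3 k)) : MeasurableSet {U | circuitOf k p n N U = Γ₀} :=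
  (measurableSet_minCircuit_eq Γ₀).preimage (measurable_configOfLabels p (slabGraph 3 k))

end Measurable

end NTW17

end Literature.Probability.Percolation
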